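import Mathlib
import Summits.Ventures.PercRepro2.HCov
import Summits.Ventures.PercRepro2.BHKAvoid
import Summits.Ventures.PercRepro2.ISplit
import Summits.Ventures.PercRepro2.CovFourTerm
import Summits.Ventures.PercRepro2.FirstOrderTerms
import Summits.Ventures.PercRepro2.FirstOrderRoot
import Summits.Ventures.PercRepro2.FirstOrderSlope
import Summits.Ventures.PercRepro2.FirstOrderSlopeSbar
import Summits.Ventures.PercRepro2.PendantW
import Summits.Ventures.PercRepro2.PendantCovMass

/-!
# The pendant-root condition `(K)` is a theorem modulo the covariance-mass monotonicity `Theta ≥ 0`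
(blind cell PercRepro2, p5 g23; `proofs/P5-OEDGE.md` §29, `S4-HARDSTEP.md` v97)

`(K) := D·Φ/D₀ + (γ − γ₀)·W` is the single-instance condition under which `(HCOV)` at the
contraction gives the pendant-root polarisation `B2 ≥ 0` (§27 addendum 3: `2′PROOT ⟸ (HCOV) ∧ (K)`).
Cleared by `D₀·D` it reads

  `Kc := D²·Φ + (D_o·D₀ − D·D_o⁰)·W`

with `Φ = FirstOrder.Phi (z := a₂)` (`Phi_nonneg`) and `W` the functional of `W_nonneg`. Its two
regimes: for `γ ≥ γ₀` (`D·D_o⁰ ≤ D_o·D₀`) both terms are non-negative (`Kc_nonneg_of_hi`); for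
`γ ≤ γ₀` the derivative-form identity

  `Kc = D₀·D·(D·Afo + D·Bfo + Cc + Dmix) − D₀·(D_o·D₀ − D·D_o⁰)·slopeGsbar`  (`Kc_eq_four`)

(`D·Ψ(β,γ) = D·A + D·B(β) + C(γ)·D + D·D(β,γ)`, the four-term anatomy of the mixed corner;
`slopeGsbar = P(Q)·∂_gΨ(σ̄_b) ≥ 0`) shows `Kc ≥ 0` as soon as the D-part `Dmix ≥ 0`
(`Afo_nonneg`, `Bfo_nonneg`, `Cc_nonneg`), which `PendantCovMass.Dmix_nonneg_of_Theta` gives from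
`Theta ≥ 0`. Hence **`Kc_nonneg_of_Theta : 0 ≤ Theta → 0 ≤ Kc`** on every instance.
-/

namespace Summit.Ventures.PercRepro2

open UnionCluster

namespace CovForm

namespace FirstOrder

section Sets

variable {V : Type*} {E : Type*} [Fintype E] [DecidableEq E] [Fintype V] [DecidableEq V]

omit [Fintype E] [DecidableEq E] [Fintype V] [DecidableEq V] in
/-- `{a₃ ↮ a₁} ∩ {a₃ ↔ a₂} = T` (the event of `Dfo` at `z = a₂`). -/
lemma avoid_a3_inter_conn_eq_T (ends : E → Sym2 V) (a₁ a₂ a₃ : V) :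
    avoidAll ends a₃ {a₁} ∩ connEvent ends a₃ a₂ = TEvent ends a₁ a₂ a₃ := by
  rw [TEvent_eq_clusterIn_inter_avoid, ← connEvent_eq_clusterInEvent, Set.inter_comm]

end Sets

section Main

variable {V : Type*} {E : Type*} [Fintype E] [DecidableEq E] [Fintype V] [DecidableEq V]
  {R : Type*} [Field R] [LinearOrder R] [IsStrictOrderedRing R]

/-- The functional `W` of `W_nonneg`:
`W = (D − Q·D₀)·(P(PD, bH) + P(T, bH) − P(T, bL)) + t·(D·β − D₀·(P(Q, bL) − P(Q, bH)))`. -/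
noncomputable def Wfun (p : E → R) (ends : E → Sym2 V) (a₁ a₂ a₃ b : V) : R :=
  (prob p (PDEvent ends a₁ a₂ a₃) - prob p (avoidAll ends a₂ {a₁}) * D0 p ends a₁ a₃) *
      (prob p (PDEvent ends a₁ a₂ a₃ ∩ connEvent ends a₂ b) +
        prob p (TEvent ends a₁ a₂ a₃ ∩ connEvent ends a₂ b) -
        prob p (TEvent ends a₁ a₂ a₃ ∩ connEvent ends a₁ b)) +
    prob p (TEvent ends a₁ a₂ a₃) *
      (prob p (PDEvent ends a₁ a₂ a₃) * beta p ends a₁ b -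
        D0 p ends a₁ a₃ * (prob p (avoidAll ends a₂ {a₁} ∩ connEvent ends a₁ b) -
          prob p (avoidAll ends a₂ {a₁} ∩ connEvent ends a₂ b)))

/-- `0 ≤ Wfun` (`W_nonneg`). -/
theorem Wfun_nonneg (p : E → R) (hp : IsProbVec p) (ends : E → Sym2 V) (a₁ a₂ a₃ b : V) :
    0 ≤ Wfun p ends a₁ a₂ a₃ b :=
  W_nonneg p hp ends a₁ a₂ a₃ b

/-- **The cleared pendant-root condition** `Kc = D₀·D·(K) = D²·Φ + (D_o·D₀ − D·D_o⁰)·W`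
(`Φ` at `z = a₂`). -/
noncomputable def Kc (p : E → R) (ends : E → Sym2 V) (o a₁ a₂ a₃ b : V) : R :=
  prob p (PDEvent ends a₁ a₂ a₃) ^ 2 * Phi p ends o a₁ a₃ b a₂ +
    (Do p ends o a₁ a₂ a₃ * D0 p ends a₁ a₃ -
        prob p (PDEvent ends a₁ a₂ a₃) * Do0 p ends o a₁ a₃) * Wfun p ends a₁ a₂ a₃ b

/-- **`(K)` in the regime `γ ≥ γ₀`** (`D·D_o⁰ ≤ D_o·D₀`): `Φ ≥ 0` and `W ≥ 0`. -/
theorem Kc_nonneg_of_hi (p : E → R) (hp : IsProbVec p) (ends : E → Sym2 V) (o a₁ a₂ a₃ b : V)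
    (h : prob p (PDEvent ends a₁ a₂ a₃) * Do0 p ends o a₁ a₃ ≤
      Do p ends o a₁ a₂ a₃ * D0 p ends a₁ a₃) :
    0 ≤ Kc p ends o a₁ a₂ a₃ b := by
  unfold Kc
  have h1 := Phi_nonneg p hp ends o a₁ a₃ b a₂
  have h2 := Wfun_nonneg p hp ends a₁ a₂ a₃ b
  have h3 : 0 ≤ prob p (PDEvent ends a₁ a₂ a₃) ^ 2 := sq_nonneg _
  nlinarith [mul_nonneg h3 h1, mul_nonneg (sub_nonneg.2 h) h2]

omit [Fintype V] [LinearOrder R] [IsStrictOrderedRing R] in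
/-- **The derivative-form identity**:
`Kc = D₀·D·(D·Afo + D·Bfo + Cc + Dmix) − D₀·(D_o·D₀ − D·D_o⁰)·slopeGsbar`. -/
theorem Kc_eq_four (p : E → R) (ends : E → Sym2 V) (o a₁ a₂ a₃ b : V) :
    Kc p ends o a₁ a₂ a₃ b =
      D0 p ends a₁ a₃ * prob p (PDEvent ends a₁ a₂ a₃) *
          (prob p (PDEvent ends a₁ a₂ a₃) * Afo p ends o a₁ a₃ b a₂ +
            prob p (PDEvent ends a₁ a₂ a₃) * Bfo p ends o a₁ a₃ b a₂ +
            FourTerm.Cc p ends o a₁ a₂ a₃ b + Dmix p ends o a₁ a₂ a₃ b) -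
        D0 p ends a₁ a₃ *
          (Do p ends o a₁ a₂ a₃ * D0 p ends a₁ a₃ -
            prob p (PDEvent ends a₁ a₂ a₃) * Do0 p ends o a₁ a₃) *
          slopeGsbar p ends a₁ a₂ a₃ b := by
  classical
  -- the `R`-masses of `Cfo` are `PD + T` masses
  have hRbH := ISplit.prob_PD_add_T p ends a₁ a₂ a₃ (connEvent ends a₂ b)
  have hRbHoL := ISplit.prob_PD_add_T p ends a₁ a₂ a₃ (connEvent ends a₂ b ∩ connEvent ends a₁ o)
  have hRbHoL' := ISplit.prob_PD_add_T p ends a₁ a₂ a₃ (connEvent ends a₁ o ∩ connEvent ends a₂ b)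
  -- the `T`-events of `Dfo`
  have e1 : avoidAll ends a₃ {a₁} ∩ connEvent ends a₃ a₂ ∩ connEvent ends a₁ b ∩ connEvent ends a₁ o =
      TEvent ends a₁ a₂ a₃ ∩ connEvent ends a₁ b ∩ connEvent ends a₁ o := by
    rw [avoid_a3_inter_conn_eq_T]
  have e2 : avoidAll ends a₃ {a₁} ∩ connEvent ends a₃ a₂ ∩ connEvent ends a₁ o =
      TEvent ends a₁ a₂ a₃ ∩ connEvent ends a₁ o := by
    rw [avoid_a3_inter_conn_eq_T]
  have e3 : avoidAll ends a₃ {a₁} ∩ connEvent ends a₃ a₂ ∩ connEvent ends a₁ b =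
      TEvent ends a₁ a₂ a₃ ∩ connEvent ends a₁ b := by
    rw [avoid_a3_inter_conn_eq_T]
  have e4 : avoidAll ends a₃ {a₁} ∩ connEvent ends a₃ a₂ = TEvent ends a₁ a₂ a₃ :=
    avoid_a3_inter_conn_eq_T ends a₁ a₂ a₃
  have e5 : avoidAll ends a₁ {a₂, a₃} ∩ connEvent ends a₂ b ∩ connEvent ends a₁ o =
      avoidAll ends a₁ {a₂, a₃} ∩ (connEvent ends a₂ b ∩ connEvent ends a₁ o) := by
    rw [Set.inter_assoc]
  have e6 : connEvent ends a₂ b ∩ connEvent ends a₁ o = connEvent ends a₁ o ∩ connEvent ends a₂ b :=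
    Set.inter_comm _ _
  unfold Kc Wfun Phi Cfo Dfo FourTerm.Cc Dmix slopeGsbar
  rw [e1, e2, e3, e4, e5, e6, ← hRbH, ← hRbHoL']
  ring

/-- **`(K)` in the regime `γ ≤ γ₀`** (`D_o·D₀ ≤ D·D_o⁰`), given `Theta ≥ 0`: the four-term
anatomy of the mixed corner with `Afo, Bfo, Cc ≥ 0` and `Dmix ≥ 0`, and `slopeGsbar ≥ 0`. -/
theorem Kc_nonneg_of_lo_of_Theta (p : E → R) (hp : IsProbVec p) (ends : E → Sym2 V)
    (o a₁ a₂ a₃ b : V)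
    (h : Do p ends o a₁ a₂ a₃ * D0 p ends a₁ a₃ ≤
      prob p (PDEvent ends a₁ a₂ a₃) * Do0 p ends o a₁ a₃)
    (hΘ : 0 ≤ Theta p ends o a₁ a₂ a₃ b) : 0 ≤ Kc p ends o a₁ a₂ a₃ b := by
  rw [Kc_eq_four]
  have hA := Afo_nonneg p hp ends o a₁ a₃ b a₂
  have hB := Bfo_nonneg p hp ends o a₁ a₃ b a₂
  have hC := FourTerm.Cc_nonneg p hp ends o a₁ a₂ a₃ b
  have hD := Dmix_nonneg_of_Theta p hp ends o a₁ a₂ a₃ b hΘ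
  have hS := slopeGsbar_nonneg p hp ends a₁ a₂ a₃ b
  have h0 : 0 ≤ D0 p ends a₁ a₃ := prob_nonneg hp _
  have hPD : 0 ≤ prob p (PDEvent ends a₁ a₂ a₃) := prob_nonneg hp _
  have hfour : 0 ≤ prob p (PDEvent ends a₁ a₂ a₃) * Afo p ends o a₁ a₃ b a₂ +
      prob p (PDEvent ends a₁ a₂ a₃) * Bfo p ends o a₁ a₃ b a₂ +
      FourTerm.Cc p ends o a₁ a₂ a₃ b + Dmix p ends o a₁ a₂ a₃ b := by
    have := mul_nonneg hPD hA
    have := mul_nonneg hPD hB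
    linarith
  have h1 : 0 ≤ D0 p ends a₁ a₃ * prob p (PDEvent ends a₁ a₂ a₃) *
      (prob p (PDEvent ends a₁ a₂ a₃) * Afo p ends o a₁ a₃ b a₂ +
        prob p (PDEvent ends a₁ a₂ a₃) * Bfo p ends o a₁ a₃ b a₂ +
        FourTerm.Cc p ends o a₁ a₂ a₃ b + Dmix p ends o a₁ a₂ a₃ b) :=
    mul_nonneg (mul_nonneg h0 hPD) hfour
  have h2 : D0 p ends a₁ a₃ * (Do p ends o a₁ a₂ a₃ * D0 p ends a₁ a₃ -
      prob p (PDEvent ends a₁ a₂ a₃) * Do0 p ends o a₁ a₃) * slopeGsbar p ends a₁ a₂ a₃ b ≤ 0 := by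
    have hneg : Do p ends o a₁ a₂ a₃ * D0 p ends a₁ a₃ -
        prob p (PDEvent ends a₁ a₂ a₃) * Do0 p ends o a₁ a₃ ≤ 0 := by linarith
    have := mul_nonpos_of_nonneg_of_nonpos h0 hneg
    exact mul_nonpos_of_nonpos_of_nonneg this hS
  linarith

/-- **`(K)` is a theorem modulo `Theta ≥ 0`**: on every instance, `0 ≤ Theta → 0 ≤ Kc`. -/
theorem Kc_nonneg_of_Theta (p : E → R) (hp : IsProbVec p) (ends : E → Sym2 V) (o a₁ a₂ a₃ b : V)
    (hΘ : 0 ≤ Theta p ends o a₁ a₂ a₃ b) : 0 ≤ Kc p ends o a₁ a₂ a₃ b := by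
  rcases le_total (Do p ends o a₁ a₂ a₃ * D0 p ends a₁ a₃)
      (prob p (PDEvent ends a₁ a₂ a₃) * Do0 p ends o a₁ a₃) with h | h
  · exact Kc_nonneg_of_lo_of_Theta p hp ends o a₁ a₂ a₃ b h hΘ
  · exact Kc_nonneg_of_hi p hp ends o a₁ a₂ a₃ b h

end Main

end FirstOrder

end CovForm

end Summit.Ventures.PercRepro2
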